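import Summits.Ventures.PercRepro.S2CoreTwenty

/-!
# PercRepro — THE CORANK-`≥ 29` CORE THEOREM AT LEVEL `5` AT RANK `19` (p7, gen 7; sub-claim S2; the «20» assembly)

S2CoreTwenty's argument at `p = 19`: the sizes `6 ≤ s ≤ 18` are used, subtracting the rank-`≤ 5` sets: every `s`-subset
with `6 ≤ s ≤ 18` has rank `< 19` (`|X| < 19`), so `Σ_{s=6}^{18} C(n, s) ≤ #Y + #{r ≤ 5}`
(**`choose_sum_six_eighteen_le_midCount_add`**); `#U ≤ C(n, 5)·2^{14}` as before (`f(5) ≤ 19`) and `#{r ≤ 5} ≤ 16460·C(n, 5)`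
(the level counts `C(n, k)·2^{f(k) − k}`, `C(n, k) ≤ C(n, 5)` for `k ≤ 5 ≤ n/2`, S2CoreTwenty's `choose_le_choose_five`).
The sum key `2^{24}·16426·C(n, 5) ≤ C(24, 19)·Σ_{s=6}^{18} C(n, s)` holds at `n₀ = 48` (room `1.41`, decided) and propagates to
every `n ≥ 48` (`key_sum_of_base`); `2^{38} + 42504·16460 ≤ 2^{24}·16426`. **`c025_core_five_at_nineteen_big`**: the `e`-free
core at level `5`, rank `19`, every corank `≥ 29`. Axioms: standard.
-/

open scoped Matroid

namespace PercRepro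

namespace ThmN

open Set

variable {α : Type}

/-- `Σ_{s=6}^{18} C(48, s)`, decided. -/
theorem sum_choose_fortyeight_six_eighteen : ∑ s ∈ Finset.Icc 6 18, (48).choose s = 15678561158093 := by
  decide

/-- The sum key at `p = 19`, `q = 5`, `K = 16426`, `n₀ = 48`: one numeral (room `1.41`). -/
theorem key_sum_nineteen_five_q5_base :
    2 ^ (19 + 5) * 16426 * (48).choose 5 ≤ (19 + 5).choose 19 * ∑ s ∈ Finset.Icc 6 18, (48).choose s := by
  rw [sum_choose_fortyeight_six_eighteen]
  norm_num [Nat.choose]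

/-- **`Σ_{s=6}^{18} C(n, s) ≤ #Y(19, 5) + #{r ≤ 5}`**: an `s`-subset with `6 ≤ s ≤ 18` has rank `< 19`; it is in `Y` unless
its rank is `≤ 5`. -/
theorem choose_sum_six_eighteen_le_midCount_add (M : Matroid α) [M.Finite] :
    ∑ s ∈ Finset.Icc 6 18, M.ground_finite.toFinset.card.choose s ≤
      Matroid.midCount M 19 5 + {X : Set α | X ⊆ M.E ∧ M.eRk X ≤ 5}.ncard := by
  have hE : (M.ground_finite.toFinset : Set α) = M.E := Set.Finite.coe_toFinset _
  rw [← ncard_subsets_ncard_mem M.ground_finite.toFinset (Finset.Icc 6 18)]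
  unfold Matroid.midCount
  refine le_trans (Set.ncard_le_ncard ?_ ?_) (Set.ncard_union_le _ _)
  · intro X hX
    have hXE : X ⊆ M.E := by rw [← hE]; exact hX.1
    have hXfin : X.Finite := M.ground_finite.subset hXE
    have hXc := Finset.mem_Icc.1 hX.2
    by_cases h5 : M.eRk X ≤ 5
    · exact Or.inr ⟨hXE, h5⟩
    · refine Or.inl ⟨hXE, lt_of_not_ge h5, ?_⟩
      calc M.eRk X ≤ X.encard := M.eRk_le_encard X
        _ = (X.ncard : ℕ∞) := by rw [← hXfin.cast_ncard_eq]
        _ < ((19 : ℕ) : ℕ∞) := by exact_mod_cast (show X.ncard < 19 by omega)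
  · exact (M.ground_finite.finite_subsets.subset (fun X hX => hX.1)).union
      (M.ground_finite.finite_subsets.subset (fun X hX => hX.1))

/-- **The `e`-free core at level `5`, rank `19`, every corank `≥ 29`** (`f(5) ≤ 19`): `#U ≤ C(n, 5)·2^{14}`,
`#Y ≥ Σ_{s=6}^{18} C(n, s) − #{r ≤ 5}`, `#{r ≤ 5} ≤ 16460·C(n, 5)`, and the sum key from `n₀ = 48`. -/
theorem c025_core_five_at_nineteen_big (M : Matroid α) [M.Finite] (hbig : 19 + 28 < M.E.ncard)
    (hfree : ∀ e ∈ M.E, ∃ A ⊆ M.E \ {e}, e ∉ M.closure A ∧ e ∉ M.closure ((M.E \ {e}) \ A)) : RLS M 19 5 := by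
  classical
  set n := M.E.ncard with hn_def
  have hEcard : M.ground_finite.toFinset.card = n := by
    rw [hn_def, Set.ncard_eq_toFinset_card _ M.ground_finite]
  have hL0 : ∀ e ∈ M.E, ¬ M.IsLoop e := not_isLoop_of_free M hfree
  have hBq' : ∀ X ⊆ M.E, M.eRk X ≤ 5 → X.ncard ≤ 19 := fun X hX hr =>
    ncard_le_nineteen_of_eRk_le_five_of_free M hfree hX hr
  -- (U): every rank-`5` set has `≤ 19` points
  have hU : Matroid.topCount M 19 5 ≤ n.choose 5 * 2 ^ (19 - 5) := by
    calc Matroid.topCount M 19 5 ≤ Matroid.levelCount M 5 := Matroid.topCount_le_levelCount_bot 19 5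
      _ = {X : Set α | X ⊆ M.E ∧ M.eRk X = 5}.ncard := rfl
      _ ≤ n.choose 5 * 2 ^ (19 - 5) := by rw [← hEcard]; exact ncard_eRk_eq_le_choose_mul_of_bound M 5 19 hBq'
  -- the rank-`≤ 5` sets, level by level
  have hsum5 := S2.ncard_eRk_le_le_sum M 5
  simp only [Finset.sum_range_succ, Finset.sum_range_zero, zero_add] at hsum5
  have h5 : {X : Set α | X ⊆ M.E ∧ M.eRk X = (5 : ℕ)}.ncard ≤ n.choose 5 * 2 ^ (19 - 5) :=
    S2.ncard_eRk_eq_le_choose_mul_two_pow M 5 19 hBq'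
  have h4 : {X : Set α | X ⊆ M.E ∧ M.eRk X = (4 : ℕ)}.ncard ≤ n.choose 4 * 2 ^ (10 - 4) :=
    S2.ncard_eRk_eq_le_choose_mul_two_pow M 4 10
      (fun X hX hr => ncard_le_ten_of_eRk_le_four_of_free M hfree hX hr)
  have h3 : {X : Set α | X ⊆ M.E ∧ M.eRk X = (3 : ℕ)}.ncard ≤ n.choose 3 * 2 ^ (6 - 3) :=
    S2.ncard_eRk_eq_le_choose_mul_two_pow M 3 6
      (fun X hX hr => ncard_le_six_of_eRk_le_three_of_free M hfree hX hr)
  have h2 : {X : Set α | X ⊆ M.E ∧ M.eRk X = (2 : ℕ)}.ncard ≤ n.choose 2 * 2 ^ (3 - 2) :=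
    S2.ncard_eRk_eq_le_choose_mul_two_pow M 2 3
      (fun X hX hr => by
        have := ncard_add_one_le_two_pow_of_eRk_le M hL0 hfree 2 X hX hr
        omega)
  have h1 : {X : Set α | X ⊆ M.E ∧ M.eRk X = (1 : ℕ)}.ncard ≤ n.choose 1 * 2 ^ (1 - 1) :=
    S2.ncard_eRk_eq_le_choose_mul_two_pow M 1 1
      (fun X hX hr => by
        have := ncard_add_one_le_two_pow_of_eRk_le M hL0 hfree 1 X hX hr
        omega)
  have h0 : {X : Set α | X ⊆ M.E ∧ M.eRk X = (0 : ℕ)}.ncard ≤ n.choose 0 * 2 ^ (0 - 0) :=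
    S2.ncard_eRk_eq_le_choose_mul_two_pow M 0 0
      (fun X hX hr => by
        have := ncard_add_one_le_two_pow_of_eRk_le M hL0 hfree 0 X hX hr
        omega)
  have hn10 : 10 ≤ n := by omega
  have hc4 := choose_le_choose_five n hn10 4 (by norm_num)
  have hc3 := choose_le_choose_five n hn10 3 (by norm_num)
  have hc2 := choose_le_choose_five n hn10 2 (by norm_num)
  have hc1 := choose_le_choose_five n hn10 1 (by norm_num)
  have hc0 := choose_le_choose_five n hn10 0 (by norm_num)
  have hc1' : n ≤ n.choose 5 := by have := hc1; rwa [Nat.choose_one_right] at this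
  have hc0' : 1 ≤ n.choose 5 := by have := hc0; rwa [Nat.choose_zero_right] at this
  have hA : {X : Set α | X ⊆ M.E ∧ M.eRk X ≤ 5}.ncard ≤ 16460 * n.choose 5 := by
    norm_num at h5 h4 h3 h2 h1 h0 hsum5
    omega
  -- (Y): the sizes `6 … 18`
  have hY := choose_sum_six_eighteen_le_midCount_add M
  rw [hEcard] at hY
  -- the key, propagated from `n₀ = 48`
  have key := key_sum_of_base 19 5 16426 ((19 + 5).choose 19) 48 (Finset.Icc 6 18)
    (fun s hs => by rw [Finset.mem_Icc] at hs; omega) (by norm_num)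
  have hkey := key key_sum_nineteen_five_q5_base n (by omega)
  -- the arithmetic in `ℚ`
  have hΦ := phiK_le_two_pow_div 19 5
  rw [Nat.choose_symm_add] at hΦ
  have hU0 : (0 : ℚ) ≤ (Matroid.topCount M 19 5 : ℚ) := by positivity
  have hUq : (Matroid.topCount M 19 5 : ℚ) ≤ (n.choose 5 : ℚ) * 16384 := by
    have h := hU
    rw [show (19 : ℕ) - 5 = 14 from rfl, show (2 : ℕ) ^ 14 = 16384 from rfl] at h
    exact_mod_cast h
  have hAq : ({X : Set α | X ⊆ M.E ∧ M.eRk X ≤ 5}.ncard : ℚ) ≤ 16460 * (n.choose 5 : ℚ) := by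
    exact_mod_cast hA
  have hYq : ((∑ s ∈ Finset.Icc 6 18, n.choose s : ℕ) : ℚ) ≤
      (Matroid.midCount M 19 5 : ℚ) + ({X : Set α | X ⊆ M.E ∧ M.eRk X ≤ 5}.ncard : ℚ) := by
    exact_mod_cast hY
  have hc : (19 + 5).choose 19 = 42504 := by decide
  have hc' : (19 + 5).choose 5 = 42504 := by decide
  rw [hc] at hkey
  have hkeyq : (275582550016 : ℚ) * (n.choose 5 : ℚ) ≤
      42504 * ((∑ s ∈ Finset.Icc 6 18, n.choose s : ℕ) : ℚ) := by
    have h : 275582550016 * n.choose 5 ≤ 42504 * ∑ s ∈ Finset.Icc 6 18, n.choose s := by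
      have e : 2 ^ (19 + 5) * 16426 = 275582550016 := by norm_num
      rw [e] at hkey
      exact hkey
    exact_mod_cast h
  rw [hc'] at hΦ
  have hΦq : phiK 19 5 ≤ (16777216 : ℚ) / 42504 := by
    have e : (2 : ℚ) ^ (19 + 5) = 16777216 := by norm_num
    rw [e] at hΦ
    exact_mod_cast hΦ
  rw [RLS_iff]
  have hpos : (0 : ℚ) ≤ (n.choose 5 : ℚ) := by positivity
  have hΦU : phiK 19 5 * (Matroid.topCount M 19 5 : ℚ) ≤
      (16777216 : ℚ) / 42504 * ((n.choose 5 : ℚ) * 16384) := mul_le_mul hΦq hUq hU0 (by positivity)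
  refine hΦU.trans ?_
  rw [show (16777216 : ℚ) / 42504 * ((n.choose 5 : ℚ) * 16384) = (274877906944 * (n.choose 5 : ℚ)) / 42504 by ring,
    div_le_iff₀ (by norm_num : (0 : ℚ) < 42504)]
  linarith [hkeyq, hYq, hAq, hpos]

end ThmN

end PercRepro
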